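import Summits.CriticalPhenomena.PercolationContinuityZ3.Theorems.PercNearOneGluingNoHeavyLowerTailThreePointProductFormFibreCutVertex
import HarnessLib

/-!
# The product form `#bad² ≤ #P1·#P2` in the fibre language: a part hanging at the apex is irrelevant
# (Sahi programme, prover prim-sahi-p2 gen 54)

Support file (`--supports stmt-CriticalPhenomena-4575`, helper); continues `…ThreePointProductFormFibreCutVertex` and `…FibrePendant`.  Standard
axioms, no sorries, no named facts, no definitions.  Memo `run/shared/lean/prim/prim-sahi/FROM-prim-sahi-p2-gen54-CERTIFICATE-SHAPE.md` §8.

SETTING.  A finite multigraph `(V, α, ends)`, apex `a`, and a vertex set `D ∌ s, c` HANGING at `a`: the labels split (by a decidable predicate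
`inD`) into those with all endpoints in `D ∪ {a}` and those with all endpoints outside `D` (or equal to `a`).  The reduced multigraph `H°` is
written on the same labels: `ends° l = s(a, a)` (a loop) if `inD l`, else `ends l`.  Then for EVERY configuration `z` the three events of
CONJECTURE (P) — `bad = {a ↮ s, a ↮ c, s ↮ c in z, s ↔ c in ♭z}`, `P1 = {a ↔ s, a ↮ c}`, `P2 = {a ↔ c, a ↮ s}` (`♭z = clusterFlip ends a z̄`) —
hold in `H` iff they hold in `H°`: the part hanging at the apex is irrelevant, `#bad, #P1, #P2` agree and (P) transfers both ways.
* `openGraph_loops_eq` [this work] — the open graph of `(ends°, w)` is the open graph of `(ends, w°)`, `w°` = `w` with the `D`-labels closed.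
* `reachable_apex_iff_restrict`, `reachable_iff_restrict` [this work] — connections among `{a} ∪ Dᶜ` only use labels outside `D`
  (cut-vertex locality of `…FibreCutVertex`); `flat_eq_flat_loops` — the flats of `H` and `H°` agree on the labels outside `D`.
* **`bad_iff_dangling`, `sa_iff_dangling`, `productForm_of_dangling`** [this work] — the three events agree pointwise; (P) transfers.
[folklore] (blocks hanging at a cut vertex do not affect connections among the other vertices); [cite: Gladkov2024, Conjecture 10.1 (p. 18),
arXiv:2408.08457] for (P).
-/

namespace Summit.CriticalPhenomena.PercolationContinuityZ3.Theorems.ProductFormFibre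

open Finset Literature.Probability.Percolation
open Summit.CriticalPhenomena.PercolationContinuityZ3.Theorems.ThreePointCPIClusterSwap
  (QTouch clusterFlip clusterFlip_of_qtouch clusterFlip_of_not_qtouch)

variable {V α : Type*}

section Dangling

variable [DecidableEq V] (ends : α → Sym2 V) (a : V) (D : Set V) (inD : α → Prop) [DecidablePred inD]

omit [DecidableEq V] in
/-- The open graph of the reduced multigraph (the `D`-labels made loops at `a`) is the open graph of `H` with the `D`-labels closed. [this work] -/
theorem openGraph_loops_eq (w : α → Bool) :
    openGraph (labelledOpen (fun l => if inD l then s(a, a) else ends l) w) =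
      openGraph (labelledOpen ends fun l => if inD l then false else w l) := by
  ext u v
  rw [openGraph_adj, openGraph_adj]
  constructor
  · rintro ⟨⟨l, hl, hle⟩, huv⟩
    by_cases hin : inD l
    · simp only [hin, if_true] at hle
      exfalso; apply huv
      have h1 : u ∈ (s(a, a) : Sym2 V) := by rw [hle]; exact Sym2.mem_mk_left u v
      have h2 : v ∈ (s(a, a) : Sym2 V) := by rw [hle]; exact Sym2.mem_mk_right u v
      rw [Sym2.mem_iff, or_self] at h1 h2
      rw [h1, h2]
    · simp only [hin, if_false] at hle
      exact ⟨⟨l, by simp only [hin, if_false]; exact hl, hle⟩, huv⟩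
  · rintro ⟨⟨l, hl, hle⟩, huv⟩
    by_cases hin : inD l
    · simp only [hin, if_true] at hl; exact absurd hl Bool.false_ne_true
    · simp only [hin, if_false] at hl
      exact ⟨⟨l, hl, by simp only [hin, if_false]; exact hle⟩, huv⟩

/-- The separation hypothesis of `…FibreCutVertex` for the side `T = (D ∪ {a})ᶜ`, derived from the label classification. [this work] -/
theorem separates_of_inD (hD1 : ∀ l, inD l → ∀ v ∈ ends l, v ∈ D ∨ v = a) (hD2 : ∀ l, ¬ inD l → ∀ v ∈ ends l, v ∉ D ∨ v = a) :
    ∀ l : α, (∀ v ∈ ends l, v ∈ {v : V | v ∉ D ∧ v ≠ a} ∨ v = a) ∨ (∀ v ∈ ends l, v ∉ {v : V | v ∉ D ∧ v ≠ a} ∨ v = a) := by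
  intro l
  by_cases hin : inD l
  · right; intro v hv
    rcases hD1 l hin v hv with h | h
    · left; simp only [Set.mem_setOf_eq, not_and, not_not]; exact fun h' => absurd h h'
    · exact Or.inr h
  · left; intro v hv
    by_cases hva : v = a
    · exact Or.inr hva
    · rcases hD2 l hin v hv with h | h
      · exact Or.inl ⟨h, hva⟩
      · exact absurd h hva

omit [DecidableEq V] in
/-- Closing the `D`-labels does not change the labels inside `(D ∪ {a})ᶜ ∪ {a}` that carry edges. [this work] -/
theorem agree_restrict (hD1 : ∀ l, inD l → ∀ v ∈ ends l, v ∈ D ∨ v = a) (w : α → Bool) :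
    ∀ l, (∀ v ∈ ends l, v ∈ {v : V | v ∉ D ∧ v ≠ a} ∨ v = a) → ¬ (ends l).IsDiag →
      w l = (fun l => if inD l then false else w l) l := by
  intro l hl hd
  by_cases hin : inD l
  · exfalso; apply hd
    apply isDiag_of_forall_eq (a := a)
    intro v hv
    rcases hl v hv with h | h
    · rcases hD1 l hin v hv with h' | h'
      · exact absurd h' h.1
      · exact h'
    · exact h
  · simp only [hin, if_false]

/-- **Connections from the apex into `(D ∪ {a})ᶜ` only use labels outside `D`.** [this work] -/
theorem reachable_apex_iff_restrict (hD1 : ∀ l, inD l → ∀ v ∈ ends l, v ∈ D ∨ v = a)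
    (hD2 : ∀ l, ¬ inD l → ∀ v ∈ ends l, v ∉ D ∨ v = a) (w : α → Bool) {v : V} (hv : (v ∉ D ∧ v ≠ a) ∨ v = a) :
    (openGraph (labelledOpen ends w)).Reachable a v ↔
      (openGraph (labelledOpen ends fun l => if inD l then false else w l)).Reachable a v :=
  reachable_iff_of_agree_inside ends a {v : V | v ∉ D ∧ v ≠ a} (separates_of_inD ends a D inD hD1 hD2) (fun h => h.2 rfl)
    (agree_restrict ends a D inD hD1 w) hv

omit [DecidableEq V] in
/-- Closing labels only removes connections. [folklore] -/
theorem reachable_of_reachable_restrict (w : α → Bool) {x y : V}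
    (h : (openGraph (labelledOpen ends fun l => if inD l then false else w l)).Reachable x y) :
    (openGraph (labelledOpen ends w)).Reachable x y := by
  refine h.mono fun u v huv => ?_
  rw [openGraph_adj] at huv ⊢
  obtain ⟨⟨l, hl, hle⟩, hne⟩ := huv
  by_cases hin : inD l
  · simp only [hin, if_true] at hl; exact absurd hl Bool.false_ne_true
  · simp only [hin, if_false] at hl; exact ⟨⟨l, hl, hle⟩, hne⟩

/-- **Connections between two vertices outside `D ∪ {a}` only use labels outside `D`** (a walk either avoids `a` and stays outside `D`, or
passes through `a` and splits into two apex connections). [this work] -/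
theorem reachable_iff_restrict (hD1 : ∀ l, inD l → ∀ v ∈ ends l, v ∈ D ∨ v = a)
    (hD2 : ∀ l, ¬ inD l → ∀ v ∈ ends l, v ∉ D ∨ v = a) (w : α → Bool) {x y : V}
    (hx : x ∉ D ∧ x ≠ a) (hy : y ∉ D ∧ y ≠ a) :
    (openGraph (labelledOpen ends w)).Reachable x y ↔
      (openGraph (labelledOpen ends fun l => if inD l then false else w l)).Reachable x y := by
  refine ⟨fun h => ?_, reachable_of_reachable_restrict ends inD w⟩
  have hsep := separates_of_inD ends a D inD hD1 hD2
  have haT : a ∉ {v : V | v ∉ D ∧ v ≠ a} := fun h => h.2 rfl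
  obtain ⟨p⟩ := h
  by_cases hap : a ∈ p.support
  · -- through the apex: split and transfer the two apex connections
    have h1 : (openGraph (labelledOpen ends w)).Reachable a x := ⟨(p.takeUntil a hap).reverse⟩
    have h2 : (openGraph (labelledOpen ends w)).Reachable a y := ⟨p.dropUntil a hap⟩
    exact ((reachable_apex_iff_restrict ends a D inD hD1 hD2 w (Or.inl hx)).1 h1).symm.trans
      ((reachable_apex_iff_restrict ends a D inD hD1 hD2 w (Or.inl hy)).1 h2)
  · -- avoiding the apex: the walk stays outside `D ∪ {a}` and uses labels outside `D`
    have hsupp := support_subset_of_walk ends a {v : V | v ∉ D ∧ v ≠ a} hsep haT w p hx hap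
    refine reachable_of_walk_of_labels ends w _ p fun l hl he => ?_
    have heG := p.edges_subset_edgeSet he
    have hnd : ¬ (ends l).IsDiag := by
      rw [openGraph, SimpleGraph.edgeSet_fromEdgeSet] at heG; exact heG.2
    obtain ⟨u, v, hends⟩ : ∃ u v, ends l = s(u, v) := by
      induction ends l using Sym2.ind with
      | h u v => exact ⟨u, v, rfl⟩
    rw [hends] at he
    have hu := hsupp u (p.fst_mem_support_of_mem_edges he)
    by_cases hin : inD l
    · exfalso
      rcases hD1 l hin u (by rw [hends]; exact Sym2.mem_mk_left u v) with h' | h'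
      · exact hu.1 h'
      · exact hu.2 h'
    · simp only [hin, if_false]; exact hl

/-- **The flats of `H` and `H°` agree on the labels outside `D`.** [this work] -/
theorem flat_eq_flat_loops (hD1 : ∀ l, inD l → ∀ v ∈ ends l, v ∈ D ∨ v = a)
    (hD2 : ∀ l, ¬ inD l → ∀ v ∈ ends l, v ∉ D ∨ v = a) (z : α → Bool) {l : α} (hin : ¬ inD l) :
    clusterFlip ends a (fun x => !z x) l = clusterFlip (fun l => if inD l then s(a, a) else ends l) a (fun x => !z x) l := by
  classical
  have hq : QTouch ends a (fun x => !z x) l ↔ QTouch (fun l => if inD l then s(a, a) else ends l) a (fun x => !z x) l := by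
    rw [qtouch_compl_iff, qtouch_compl_iff]
    simp only [hin, if_false]
    have key : ∀ v ∈ ends l, ((openGraph (labelledOpen ends z)).Reachable a v ↔
        (openGraph (labelledOpen (fun l => if inD l then s(a, a) else ends l) z)).Reachable a v) := by
      intro v hv
      rw [openGraph_loops_eq ends a inD z]
      have hv' : (v ∉ D ∧ v ≠ a) ∨ v = a := by
        by_cases hva : v = a
        · exact Or.inr hva
        · rcases hD2 l hin v hv with h | h
          · exact Or.inl ⟨h, hva⟩
          · exact absurd h hva
      exact reachable_apex_iff_restrict ends a D inD hD1 hD2 z hv'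
    constructor
    · rintro ⟨v, hv, hr⟩; exact ⟨v, hv, (key v hv).1 hr⟩
    · rintro ⟨v, hv, hr⟩; exact ⟨v, hv, (key v hv).2 hr⟩
  by_cases hq1 : QTouch ends a (fun x => !z x) l
  · rw [clusterFlip_of_qtouch ends a _ hq1, clusterFlip_of_qtouch _ a _ (hq.1 hq1)]
  · rw [clusterFlip_of_not_qtouch ends a _ hq1, clusterFlip_of_not_qtouch _ a _ (fun h' => hq1 (hq.2 h'))]

/-- Configurations agreeing outside `D` have the same restriction. [this work] -/
theorem restrict_eq_of_agree {w w' : α → Bool} (h : ∀ l, ¬ inD l → w l = w' l) :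
    (fun l => if inD l then false else w l) = (fun l => if inD l then false else w' l) := by
  funext l; by_cases hin : inD l
  · simp only [hin, if_true]
  · simp only [hin, if_false]; exact h l hin

/-- **`bad` is the same event in `H` and in `H°`** (terminals `s, c ∉ D ∪ {a}`). [this work] -/
theorem bad_iff_dangling (hD1 : ∀ l, inD l → ∀ v ∈ ends l, v ∈ D ∨ v = a)
    (hD2 : ∀ l, ¬ inD l → ∀ v ∈ ends l, v ∉ D ∨ v = a) {s c : V} (hs : s ∉ D ∧ s ≠ a) (hc : c ∉ D ∧ c ≠ a)
    (z : α → Bool) :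
    ((¬ (openGraph (labelledOpen ends z)).Reachable a s ∧ ¬ (openGraph (labelledOpen ends z)).Reachable a c ∧
        ¬ (openGraph (labelledOpen ends z)).Reachable s c) ∧
      (openGraph (labelledOpen ends (clusterFlip ends a fun x => !z x))).Reachable s c) ↔
    ((¬ (openGraph (labelledOpen (fun l => if inD l then s(a, a) else ends l) z)).Reachable a s ∧
        ¬ (openGraph (labelledOpen (fun l => if inD l then s(a, a) else ends l) z)).Reachable a c ∧
        ¬ (openGraph (labelledOpen (fun l => if inD l then s(a, a) else ends l) z)).Reachable s c) ∧
      (openGraph (labelledOpen (fun l => if inD l then s(a, a) else ends l)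
        (clusterFlip (fun l => if inD l then s(a, a) else ends l) a fun x => !z x))).Reachable s c) := by
  classical
  rw [openGraph_loops_eq ends a inD z, openGraph_loops_eq ends a inD,
    ← reachable_apex_iff_restrict ends a D inD hD1 hD2 z (Or.inl hs),
    ← reachable_apex_iff_restrict ends a D inD hD1 hD2 z (Or.inl hc),
    ← reachable_iff_restrict ends a D inD hD1 hD2 z hs hc]
  -- the flats: agree outside `D`, so their restrictions coincide
  have hfl : (fun l => if inD l then false else clusterFlip (fun l => if inD l then s(a, a) else ends l) a (fun x => !z x) l) =
      (fun l => if inD l then false else clusterFlip ends a (fun x => !z x) l) :=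
    restrict_eq_of_agree inD fun l hin => (flat_eq_flat_loops ends a D inD hD1 hD2 z hin).symm
  rw [hfl, ← reachable_iff_restrict ends a D inD hD1 hD2 _ hs hc]

/-- **`{a ↔ s, a ↮ c}` is the same event in `H` and in `H°`** (and, exchanging `s, c`, so is `P2`). [this work] -/
theorem sa_iff_dangling (hD1 : ∀ l, inD l → ∀ v ∈ ends l, v ∈ D ∨ v = a)
    (hD2 : ∀ l, ¬ inD l → ∀ v ∈ ends l, v ∉ D ∨ v = a) {s c : V} (hs : s ∉ D ∧ s ≠ a) (hc : c ∉ D ∧ c ≠ a)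
    (z : α → Bool) :
    ((openGraph (labelledOpen ends z)).Reachable a s ∧ ¬ (openGraph (labelledOpen ends z)).Reachable a c) ↔
    ((openGraph (labelledOpen (fun l => if inD l then s(a, a) else ends l) z)).Reachable a s ∧
      ¬ (openGraph (labelledOpen (fun l => if inD l then s(a, a) else ends l) z)).Reachable a c) := by
  rw [openGraph_loops_eq ends a inD z,
    ← reachable_apex_iff_restrict ends a D inD hD1 hD2 z (Or.inl hs),
    ← reachable_apex_iff_restrict ends a D inD hD1 hD2 z (Or.inl hc)]

end Dangling

/-! ### The transfer of (P) -/

section Transfer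

variable [Fintype α] [DecidableEq α] [DecidableEq V]

open Classical in
/-- **A PART HANGING AT THE APEX IS IRRELEVANT FOR (P).**  With `D` hanging at `a` (labels classified by `inD` as above) and terminals
`s, c ∉ D ∪ {a}`, the three counts `#bad, #P1, #P2` of `H` equal those of the reduced multigraph `H°` (the `D`-labels made loops at `a`);
in particular `(P)` for `H°` implies `(P)` for `H`. [this work] -/
theorem productForm_of_dangling (ends : α → Sym2 V) (a s c : V) (D : Set V) (inD : α → Prop)
    (hD1 : ∀ l, inD l → ∀ v ∈ ends l, v ∈ D ∨ v = a) (hD2 : ∀ l, ¬ inD l → ∀ v ∈ ends l, v ∉ D ∨ v = a)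
    (hs : s ∉ D ∧ s ≠ a) (hc : c ∉ D ∧ c ≠ a)
    (hP : (univ.filter fun z : α → Bool =>
        (¬ (openGraph (labelledOpen (fun l => if inD l then s(a, a) else ends l) z)).Reachable a s ∧
            ¬ (openGraph (labelledOpen (fun l => if inD l then s(a, a) else ends l) z)).Reachable a c ∧
            ¬ (openGraph (labelledOpen (fun l => if inD l then s(a, a) else ends l) z)).Reachable s c) ∧
          (openGraph (labelledOpen (fun l => if inD l then s(a, a) else ends l)
            (clusterFlip (fun l => if inD l then s(a, a) else ends l) a fun x => !z x))).Reachable s c).card ^ 2 ≤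
      (univ.filter fun z : α → Bool =>
        (openGraph (labelledOpen (fun l => if inD l then s(a, a) else ends l) z)).Reachable a s ∧
          ¬ (openGraph (labelledOpen (fun l => if inD l then s(a, a) else ends l) z)).Reachable a c).card *
      (univ.filter fun z : α → Bool =>
        (openGraph (labelledOpen (fun l => if inD l then s(a, a) else ends l) z)).Reachable a c ∧
          ¬ (openGraph (labelledOpen (fun l => if inD l then s(a, a) else ends l) z)).Reachable a s).card) :
    (univ.filter fun z : α → Bool =>
        (¬ (openGraph (labelledOpen ends z)).Reachable a s ∧ ¬ (openGraph (labelledOpen ends z)).Reachable a c ∧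
          ¬ (openGraph (labelledOpen ends z)).Reachable s c) ∧
        (openGraph (labelledOpen ends (clusterFlip ends a fun x => !z x))).Reachable s c).card ^ 2 ≤
    (univ.filter fun z : α → Bool =>
        (openGraph (labelledOpen ends z)).Reachable a s ∧ ¬ (openGraph (labelledOpen ends z)).Reachable a c).card *
    (univ.filter fun z : α → Bool =>
        (openGraph (labelledOpen ends z)).Reachable a c ∧ ¬ (openGraph (labelledOpen ends z)).Reachable a s).card := by
  have e1 := Finset.filter_congr (s := (univ : Finset (α → Bool)))
    fun z _ => bad_iff_dangling ends a D inD hD1 hD2 hs hc z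
  have e2 := Finset.filter_congr (s := (univ : Finset (α → Bool)))
    fun z _ => sa_iff_dangling ends a D inD hD1 hD2 hs hc z
  have e3 := Finset.filter_congr (s := (univ : Finset (α → Bool)))
    fun z _ => sa_iff_dangling ends a D inD hD1 hD2 hc hs z
  rw [e1, e2, e3]
  exact hP

end Transfer

end Summit.CriticalPhenomena.PercolationContinuityZ3.Theorems.ProductFormFibre
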